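import Summits.QuantumFields.YangMills.Theorems.SmallFieldWideningLargeFieldMassRefinementTailStubBoundedHeight
import Summits.QuantumFields.YangMills.Theorems.SmallFieldWideningLargeFieldMassRefinementTailSeriesTail

/-!
# Route `SmallFieldWidening`, crux `PlainStabAdd` (stmt-QuantumFields-27718, rev 2 of the route file — first filed as 27684; LINE g6-B «additive unit-stability ladder» of planner ym-idea-1 g6,
# child of crux r3 `LargeFieldMassRefinementTail` stmt-QuantumFields-22884) — THE RESTRICT HALF OF THE LINE: `PlainStabAdd` FROM A PURELY
# MULTIPLICATIVE ONE-STEP COMPARISON ON A LOCAL FINEST-SMALL-FIELD EVENT; the additive slack is DISCHARGED from the tree's finest-height tail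
# (support file; width seat `ym-line-sfw-p2-w3` gen 24; `PlainStabAdd`, r3 and rung R3 stay OPEN — the YM mass gap is NOT proved by any of this)

WHAT.  `PlainStabAdd` asks, along the cutoff ladder `K → K+1` of ONE family at ONE unit coupling `γ`, for the one-sided stability
`c_{K+1}(q) ≤ e^{ρ_K}·c_K(q) + τ_K` (`K ≥ 1`) of the tail `c_K(q) = Gibbs_K{θ(0) ≤ |Ū^K(∂q) − 1|}` of ONE unit plaquette `q` of the fully
block-averaged field, with every interval sum `Σ_{k≤j<K} ρ_j ≤ A_η + η·p(√γ)²` and an additive slack `τ ≥ 0`, `Σ_{1≤k<K} τ_k ≤ C_τ γ^{-N_τ} e^{−c_τ p(√γ)²}`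
— `C_τ, c_τ, N_τ` free of `γ`, `K` and the VOLUME.  This file proves it from the hypothesis `LocalStep` of ★★ `plainStabAdd_of_localStep`:
the SAME comparison WITHOUT additive slack but with the left-hand event INTERSECTED with «every finest plaquette of a supplier-chosen set `S_K`
of run `K+1`, `|S_K| ≤ (L^{K+1})^M`, is `θ_{b'}(K+1)`-small» (`M` and the guard profile `b' > 0` are the supplier's, chosen with `γ₁`).
The slack is then `τ_K := |S_K|·C·(γL^{-(K+1)})^{-N}·e^{−c·p_{b'}(g_{K+1})²}` — the union bound over `S_K` of the VOLUME-UNIFORM finest-height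
tail `FirstExitDeepBoundedHeight.perPlaquette_boundedHeight_uniform 0` — and §2 shows `Σ_{1≤k<K} τ_k ≤ 2C e^{c b'²} e^{B²/(4α)}·γ^{-N}·e^{−c p_{b'}(√γ)²}`
(`α = c b'² log²L/4`, `B = (M+N) log L + log 2`): the profile grows at least quadratically down the ladder ON TOP of its unit value
(§1 `pFun_sq_refine_ge`: `p(g_k)² ≥ p(√γ)² + b²((k log L/2)² − 1)`, superadditivity of `t ↦ t^{p₀}`), and Gaussian beats exponential
(`exp_linear_sub_sq_le_geometric`, completing the square); `p_{b'}² = (b'/b₀)² p_{b₀}²` converts to the crux's profile (`c_τ = c·(b'/b₀)²`).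

WHY.  It isolates the analytic content of LINE g6-B: after this file the crux `PlainStabAdd` (hence, by the planner's glue, r3 22884 and
26243 / 19936) follows from ONE purely multiplicative, one-sided, one-UV-step comparison restricted to a local small-field event of polynomial
size — the shape a small-field renormalisation step ([Balaban1985UV3] (7), (70)–(71); [Balaban1987RG1] Thm 1) can address; the large fields of
the new finest level are already paid for here, uniformly in the volume.

WHAT THIS IS NOT.  `LocalStep` is NOT proved (it is the crux's open content); no estimate of Bałaban's programme is proved; nothing bears on the
Yang–Mills mass gap; rung R3 (`YM3TorusSU2`) is a RECORD rung; cruxes 27718 / 22884 stay open.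

References: T. Bałaban, Commun. Math. Phys. **102** (1985) 255–275 [Balaban1985UV3] ((7) p.257, (70)–(71) p.273); CMP **109** (1987) 249–301
[Balaban1987RG1] (Thm 1 p.259).
-/

noncomputable section

open MeasureTheory Filter Topology
open scoped BigOperators
open Literature.MathematicalPhysics.QuantumFieldTheory.Balaban1983to89
open Literature.MathematicalPhysics.QuantumFieldTheory.Balaban1983to89.Missing
open Literature.MathematicalPhysics.QuantumFieldTheory.Balaban1983to89.T3ContinuumYM3Torus
open Literature.MathematicalPhysics.QuantumFieldTheory.Balaban1983to89.T3UnitScaleTilt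
open Literature.MathematicalPhysics.QuantumFieldTheory.Balaban1983to89.T3UnitLawDensityEML (ℰp)
open Literature.MathematicalPhysics.QuantumFieldTheory.Balaban1983to89.T3LevelShift
open Summit.QuantumFields.YangMills.Theorems.FirstExitDeepBoundedHeight (perPlaquette_boundedHeight_uniform)
open Summit.QuantumFields.YangMills.Theorems.LargeFieldMassRefinementTail (quadratic_le_sq_div)

namespace Summit.QuantumFields.YangMills.Theorems.PlainStabAddOfLocalStep

/-! ## §1 Profile arithmetic along the cutoff ladder -/

/-- `1 + log g_k⁻¹ = (1 + log (√γ)⁻¹) + k·(log L)/2` for `g_k = √(γL^{-k})`. [folklore] -/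
theorem one_add_log_inv_sqrt_refine {L : ℕ} (hL : 1 < L) {γ : ℝ} (hγ : 0 < γ) (k : ℕ) :
    1 + Real.log (Real.sqrt (γ * ((L : ℝ)⁻¹) ^ k))⁻¹ =
      (1 + Real.log (Real.sqrt γ)⁻¹) + (k : ℝ) * Real.log L / 2 := by
  have hL0 : (0 : ℝ) < L := by exact_mod_cast (zero_lt_one.trans hL)
  have hx : 0 < γ * ((L : ℝ)⁻¹) ^ k := by positivity
  rw [Real.log_inv, Real.log_inv, Real.log_sqrt hx.le, Real.log_sqrt hγ.le, Real.log_mul hγ.ne' (by positivity),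
    Real.log_pow, Real.log_inv]
  ring

/-- **The Bałaban profile grows at least quadratically down the ladder, ON TOP of its unit value**:
`p(√γ)² + b₀²((k log L/2)² − 1) ≤ p(g_k)²` (`0 < γ ≤ 1`, `p₀ ≥ 1`; superadditivity of `t ↦ t^{p₀}`). [folklore] -/
theorem pFun_sq_refine_ge {L : ℕ} (hL : 1 < L) {γ b₀ p₀ : ℝ} (hγ : 0 < γ) (hγ1 : γ ≤ 1) (hb₀ : 0 < b₀)
    (hp₀ : 1 ≤ p₀) (k : ℕ) :
    B10.pFun b₀ p₀ (Real.sqrt γ) ^ 2 + b₀ ^ 2 * (((k : ℝ) * Real.log L / 2) ^ 2 - 1) ≤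
      B10.pFun b₀ p₀ (Real.sqrt (γ * ((L : ℝ)⁻¹) ^ k)) ^ 2 := by
  set u : ℝ := 1 + Real.log (Real.sqrt γ)⁻¹ with hu
  set v : ℝ := (k : ℝ) * Real.log L / 2 with hv
  have hℓ : 0 ≤ Real.log L := Real.log_nonneg (by exact_mod_cast hL.le)
  have hv0 : 0 ≤ v := by positivity
  have hu1 : 1 ≤ u := by
    have hs1 : Real.sqrt γ ≤ 1 := Real.sqrt_le_one.mpr hγ1
    have hs0 : 0 < Real.sqrt γ := Real.sqrt_pos.mpr hγ
    have : 0 ≤ Real.log (Real.sqrt γ)⁻¹ := Real.log_nonneg ((one_le_inv₀ hs0).mpr hs1)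
    linarith
  have hu0 : 0 ≤ u := zero_le_one.trans hu1
  have key : B10.pFun b₀ p₀ (Real.sqrt (γ * ((L : ℝ)⁻¹) ^ k)) = b₀ * (u + v) ^ p₀ := by
    unfold B10.pFun
    rw [one_add_log_inv_sqrt_refine hL hγ k]
  have key0 : B10.pFun b₀ p₀ (Real.sqrt γ) = b₀ * u ^ p₀ := rfl
  rw [key, key0]
  have hsuper : u ^ p₀ + v ^ p₀ ≤ (u + v) ^ p₀ := Real.add_rpow_le_rpow_add hu0 hv0 hp₀
  have hup : 0 ≤ u ^ p₀ := Real.rpow_nonneg hu0 _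
  have hvp : 0 ≤ v ^ p₀ := Real.rpow_nonneg hv0 _
  have hv2 : v ^ 2 - 1 ≤ (v ^ p₀) ^ 2 := by
    rcases le_or_gt 1 v with h1 | h1
    · have hle : v ≤ v ^ p₀ := by
        calc v = v ^ (1 : ℝ) := (Real.rpow_one v).symm
          _ ≤ v ^ p₀ := Real.rpow_le_rpow_of_exponent_le h1 hp₀
      have := pow_le_pow_left₀ hv0 hle 2
      linarith
    · have : v ^ 2 < 1 := pow_lt_one₀ hv0 h1 two_ne_zero
      nlinarith [sq_nonneg (v ^ p₀)]
  have hb2 : 0 ≤ b₀ ^ 2 := sq_nonneg _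
  have h3 : 0 ≤ u ^ p₀ * v ^ p₀ := mul_nonneg hup hvp
  calc (b₀ * u ^ p₀) ^ 2 + b₀ ^ 2 * (v ^ 2 - 1)
      ≤ (b₀ * u ^ p₀) ^ 2 + b₀ ^ 2 * (v ^ p₀) ^ 2 := by nlinarith [mul_le_mul_of_nonneg_left hv2 hb2]
    _ ≤ (b₀ * (u ^ p₀ + v ^ p₀)) ^ 2 := by nlinarith [h3, hb2]
    _ ≤ (b₀ * (u + v) ^ p₀) ^ 2 :=
        pow_le_pow_left₀ (by positivity) (mul_le_mul_of_nonneg_left hsuper hb₀.le) 2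

/-- **Gaussian beats exponential**: `exp(D·k − α·k²) ≤ exp((D + log 2)²/(4α))·(1/2)^k` for `α > 0`. [folklore] -/
theorem exp_linear_sub_sq_le_geometric {α : ℝ} (hα : 0 < α) (D : ℝ) (k : ℕ) :
    Real.exp (D * k - α * (k : ℝ) ^ 2) ≤ Real.exp ((D + Real.log 2) ^ 2 / (4 * α)) * (1 / 2 : ℝ) ^ k := by
  have hq := quadratic_le_sq_div hα (D + Real.log 2) (k : ℝ)
  have h2 : Real.exp ((k : ℝ) * (-Real.log 2)) = (1 / 2 : ℝ) ^ k := by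
    rw [Real.exp_nat_mul, Real.exp_neg, Real.exp_log two_pos, one_div]
  rw [← h2, ← Real.exp_add]
  exact Real.exp_le_exp.mpr (by linarith)

/-- `(L : ℝ)^n = exp(n log L)`. [folklore] -/
theorem natCast_pow_eq_exp {L : ℕ} (hL : 1 < L) (n : ℕ) : ((L : ℝ)) ^ n = Real.exp ((n : ℝ) * Real.log L) := by
  have hL0 : (0 : ℝ) < L := by exact_mod_cast (zero_lt_one.trans hL)
  rw [Real.exp_nat_mul, Real.exp_log hL0]


/-! ## §2 The additive slack of the ladder is summable in the printed form -/

/-- **One slack term**: a polynomially large set of finest plaquettes (`card ≤ (L^n)^M`) times the finest per-plaquette tail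
`C·(γL^{-n})^{-N}·e^{−c·p(g_n)²}` is at most `[C e^{c b₀²} e^{B²/(4α)}]·γ^{-N}·e^{−c·p(√γ)²}·(1/2)^n`
(`α = c b₀² log²L/4`, `B = (M+N) log L + log 2`). [folklore] -/
theorem slack_term_le {L : ℕ} (hL : 1 < L) (M N : ℕ) {b₀ p₀ c C γ : ℝ} (hb₀ : 0 < b₀) (hp₀ : 1 ≤ p₀) (hc : 0 < c)
    (hC : 0 ≤ C) (hγ : 0 < γ) (hγ1 : γ ≤ 1) {card : ℝ} (n : ℕ) (hcard : card ≤ ((L : ℝ) ^ n) ^ M) :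
    card * (C * ((γ * ((L : ℝ)⁻¹) ^ n)⁻¹) ^ N * Real.exp (-(c * B10.pFun b₀ p₀ (Real.sqrt (γ * ((L : ℝ)⁻¹) ^ n)) ^ 2))) ≤
      (C * Real.exp (c * b₀ ^ 2) *
          Real.exp ((((M : ℝ) + N) * Real.log L + Real.log 2) ^ 2 / (4 * (c * b₀ ^ 2 * Real.log L ^ 2 / 4)))) *
        (γ⁻¹) ^ N * Real.exp (-(c * B10.pFun b₀ p₀ (Real.sqrt γ) ^ 2)) * (1 / 2 : ℝ) ^ n := by
  set ℓ := Real.log L with hℓ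
  set α := c * b₀ ^ 2 * ℓ ^ 2 / 4 with hαdef
  set P0 := B10.pFun b₀ p₀ (Real.sqrt γ) ^ 2 with hP0
  set Pn := B10.pFun b₀ p₀ (Real.sqrt (γ * ((L : ℝ)⁻¹) ^ n)) ^ 2 with hPn
  have hℓ0 : 0 < ℓ := Real.log_pos (by exact_mod_cast hL)
  have hα : 0 < α := by positivity
  have hL0 : (0 : ℝ) < L := by exact_mod_cast (zero_lt_one.trans hL)
  -- (i) the inverse coupling
  have hinv : ((γ * ((L : ℝ)⁻¹) ^ n)⁻¹) ^ N = (γ⁻¹) ^ N * ((L : ℝ) ^ n) ^ N := by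
    rw [mul_inv, inv_pow ((L : ℝ)) n, inv_inv, mul_pow]
  -- (ii) the Gaussian factor
  have hP := pFun_sq_refine_ge hL hγ hγ1 hb₀ hp₀ n
  have hgauss : Real.exp (-(c * Pn)) ≤ Real.exp (-(c * P0)) * Real.exp (c * b₀ ^ 2) * Real.exp (-(α * (n : ℝ) ^ 2)) := by
    rw [← Real.exp_add, ← Real.exp_add]
    refine Real.exp_le_exp.mpr ?_
    have h1 : c * (P0 + b₀ ^ 2 * (((n : ℝ) * ℓ / 2) ^ 2 - 1)) ≤ c * Pn := mul_le_mul_of_nonneg_left hP hc.le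
    have hα' : α * (n : ℝ) ^ 2 = c * (b₀ ^ 2 * ((n : ℝ) * ℓ / 2) ^ 2) := by rw [hαdef]; ring
    nlinarith [h1, hα']
  -- (iii) polynomial × Gaussian ≤ constant × geometric
  have hgeo : ((L : ℝ) ^ n) ^ M * ((L : ℝ) ^ n) ^ N * Real.exp (-(α * (n : ℝ) ^ 2)) ≤
      Real.exp ((((M : ℝ) + N) * ℓ + Real.log 2) ^ 2 / (4 * α)) * (1 / 2 : ℝ) ^ n := by
    have hpow : ((L : ℝ) ^ n) ^ M * ((L : ℝ) ^ n) ^ N = Real.exp ((((M : ℝ) + N) * ℓ) * n) := by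
      rw [← pow_add, ← pow_mul, natCast_pow_eq_exp hL, ← hℓ]
      push_cast
      ring_nf
    rw [hpow, ← Real.exp_add]
    have h := exp_linear_sub_sq_le_geometric hα (((M : ℝ) + N) * ℓ) n
    have heq : (((M : ℝ) + N) * ℓ) * n + -(α * (n : ℝ) ^ 2) = (((M : ℝ) + N) * ℓ) * n - α * (n : ℝ) ^ 2 := by ring
    rw [heq]
    exact h
  -- assemble
  have hCI : 0 ≤ C * ((γ * ((L : ℝ)⁻¹) ^ n)⁻¹) ^ N := by positivity
  calc card * (C * ((γ * ((L : ℝ)⁻¹) ^ n)⁻¹) ^ N * Real.exp (-(c * Pn)))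
      ≤ ((L : ℝ) ^ n) ^ M * (C * ((γ * ((L : ℝ)⁻¹) ^ n)⁻¹) ^ N *
          (Real.exp (-(c * P0)) * Real.exp (c * b₀ ^ 2) * Real.exp (-(α * (n : ℝ) ^ 2)))) :=
        mul_le_mul hcard (mul_le_mul_of_nonneg_left hgauss hCI) (by positivity) (by positivity)
    _ = C * Real.exp (c * b₀ ^ 2) * (γ⁻¹) ^ N * Real.exp (-(c * P0)) *
          (((L : ℝ) ^ n) ^ M * ((L : ℝ) ^ n) ^ N * Real.exp (-(α * (n : ℝ) ^ 2))) := by rw [hinv]; ring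
    _ ≤ C * Real.exp (c * b₀ ^ 2) * (γ⁻¹) ^ N * Real.exp (-(c * P0)) *
          (Real.exp ((((M : ℝ) + N) * ℓ + Real.log 2) ^ 2 / (4 * α)) * (1 / 2 : ℝ) ^ n) :=
        mul_le_mul_of_nonneg_left hgeo (by positivity)
    _ = _ := by ring

/-- **The slack sum of the ladder**: `Σ_{k₀ ≤ k < K} |S_k|·C(γL^{-(k+1)})^{-N} e^{−c p(g_{k+1})²} ≤ C_τ·γ^{-N}·e^{−c p(√γ)²}` for all `K`,
with `C_τ = 2·C e^{c b₀²} e^{B²/(4α)}` depending on `(L, M, N, c, b₀, C)` only — no `γ`, no `K`, no volume. [folklore] -/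
theorem slack_sum_le {L : ℕ} (hL : 1 < L) (M N k₀ : ℕ) {b₀ p₀ c C γ : ℝ} (hb₀ : 0 < b₀) (hp₀ : 1 ≤ p₀) (hc : 0 < c)
    (hC : 0 ≤ C) (hγ : 0 < γ) (hγ1 : γ ≤ 1) (card : ℕ → ℝ)
    (hcard : ∀ k, k₀ ≤ k → card k ≤ ((L : ℝ) ^ (k + 1)) ^ M) (K : ℕ) :
    ∑ k ∈ Finset.Ico k₀ K, card k * (C * ((γ * ((L : ℝ)⁻¹) ^ (k + 1))⁻¹) ^ N *
        Real.exp (-(c * B10.pFun b₀ p₀ (Real.sqrt (γ * ((L : ℝ)⁻¹) ^ (k + 1))) ^ 2))) ≤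
      2 * (C * Real.exp (c * b₀ ^ 2) *
          Real.exp ((((M : ℝ) + N) * Real.log L + Real.log 2) ^ 2 / (4 * (c * b₀ ^ 2 * Real.log L ^ 2 / 4)))) *
        (γ⁻¹) ^ N * Real.exp (-(c * B10.pFun b₀ p₀ (Real.sqrt γ) ^ 2)) := by
  set Q := (C * Real.exp (c * b₀ ^ 2) *
      Real.exp ((((M : ℝ) + N) * Real.log L + Real.log 2) ^ 2 / (4 * (c * b₀ ^ 2 * Real.log L ^ 2 / 4)))) *
    (γ⁻¹) ^ N * Real.exp (-(c * B10.pFun b₀ p₀ (Real.sqrt γ) ^ 2)) with hQ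
  have hQ0 : 0 ≤ Q := by positivity
  calc ∑ k ∈ Finset.Ico k₀ K, card k * (C * ((γ * ((L : ℝ)⁻¹) ^ (k + 1))⁻¹) ^ N *
          Real.exp (-(c * B10.pFun b₀ p₀ (Real.sqrt (γ * ((L : ℝ)⁻¹) ^ (k + 1))) ^ 2)))
      ≤ ∑ k ∈ Finset.Ico k₀ K, Q * (1 / 2 : ℝ) ^ (k + 1) :=
        Finset.sum_le_sum fun k hk =>
          slack_term_le hL M N hb₀ hp₀ hc hC hγ hγ1 (k + 1) (hcard k (Finset.mem_Ico.mp hk).1)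
    _ = Q * ∑ k ∈ Finset.Ico k₀ K, (1 / 2 : ℝ) ^ (k + 1) := by rw [Finset.mul_sum]
    _ ≤ Q * 2 := by
        refine mul_le_mul_of_nonneg_left ?_ hQ0
        calc ∑ k ∈ Finset.Ico k₀ K, (1 / 2 : ℝ) ^ (k + 1)
            ≤ ∑ k ∈ Finset.Ico k₀ K, (1 / 2 : ℝ) ^ k :=
              Finset.sum_le_sum fun k _ => pow_le_pow_of_le_one (by norm_num) (by norm_num) (Nat.le_succ k)
          _ ≤ ∑ k ∈ Finset.range K, (1 / 2 : ℝ) ^ k := by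
              refine Finset.sum_le_sum_of_subset_of_nonneg ?_ (fun _ _ _ => by positivity)
              rw [Finset.range_eq_Ico]
              exact Finset.Ico_subset_Ico (Nat.zero_le k₀) le_rfl
          _ ≤ 2 := sum_geometric_two_le K
    _ = _ := by rw [hQ]; ring

/-- Profile rescaling: `p_{b'}(g)² = (b'/b₀)²·p_{b₀}(g)²`. [folklore] -/
theorem pFun_sq_rescale {b₀ : ℝ} (hb₀ : b₀ ≠ 0) (b' p₀ g : ℝ) :
    B10.pFun b' p₀ g ^ 2 = (b' / b₀) ^ 2 * B10.pFun b₀ p₀ g ^ 2 := by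
  unfold B10.pFun
  field_simp

/-- Threshold rescaling: `θ_{b₀/2}(i) = θ_{b₀}(i)/2` (the profile is linear in `b₀`). [folklore] -/
theorem θBal_half (L : ℕ) (γ b₀ p₀ : ℝ) (i : ℕ) : θBal L γ (b₀ / 2) p₀ i = θBal L γ b₀ p₀ i / 2 := by
  unfold θBal B10.pFun
  ring

/-! ## §3 `PlainStabAdd` (stmt-QuantumFields-27718, rev 2 of the route) from the LOCAL ONE-STEP COMPARISON -/

/-- ★★ **`PlainStabAdd` ⇐ `LocalStep` — THE RESTRICT HALF OF LINE g6-B** (rev-2 shape of the crux: prover-chosen starting run `k₀ ≥ 1`, threshold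
modulation `t_K ∈ [1/2, 1]`).  Hypothesis `LocalStep` (never asserted; the crux's open content): for every `L, b₀ > 0, p₀ > 2` there are a starting run
`k₀ ≥ 1`, a LOCALITY EXPONENT `M`, a threshold `γ₁ ∈ (0,1]` and a GUARD PROFILE `b' > 0` such that for every `η > 0` there is `A` with: for every family `F`
(`F.L = L`, any volume), every `0 < γ ≤ γ₁` and every unit plaquette label `q` there are one-step slacks `ρ_K` (EVERY interval sum `Σ_{k ≤ j < K} ρ_j ≤ A + η·p(√γ)²`,
`k ≥ k₀`), modulations `t_K ∈ [1/2, 1]` and, for every run `K ≥ k₀`, a set `S_K` of FINEST plaquettes of run `K+1` with `|S_K| ≤ (L^{K+1})^M` (the supplier's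
choice: the blocks above `q` and a collar) such that
  `Gibbs_{K+1}( {t_{K+1}θ(0) ≤ |Ū^{K+1}(∂q) − 1|} ∩ {every p ∈ S_K has |U(∂p) − 1| < θ_{b'}(K+1)} ) ≤ e^{ρ_K}·Gibbs_K{t_Kθ(0) ≤ |Ū^K(∂q) − 1|}`
— a PURELY MULTIPLICATIVE one-step, one-sided comparison, restricted to the local finest-small-field event (what a small-field RG step can address).
CONCLUSION: the crux `PlainStabAdd` BY NAME — its BASE at run `k₀` is discharged from the tree's volume-uniform bounded-height tail
`FirstExitDeepBoundedHeight.perPlaquette_boundedHeight_uniform k₀` at profile `b₀/2` (`t_{k₀} ≥ 1/2`, `θ_{b₀/2} = θ_{b₀}/2`, `c_b = c/4`), its ADDITIVE SLACK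
`τ_K := |S_K|·C·(γL^{-(K+1)})^{-N}·e^{−c·p_{b'}(g_{K+1})²}` from the finest-height tail (`j₀ = 0`, union bound over `S_K`) and `slack_sum_le`
(`Σ_{k₀≤k<K} τ_k ≤ C_τ γ^{-N} e^{−c_τ p(√γ)²}`, `c_τ = c·(b'/b₀)²`, `C_τ` free of `γ, K` and the volume), and `η := min(c_b, c_τ)/2`.  Conditional certificate:
`LocalStep` is NOT proved; nothing about the mass gap; rung R3 is a RECORD rung. [cite: Balaban1985UV3, (7) p.257 and (70)-(71) p.273; Balaban1987RG1, Thm 1 p.259] -/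
theorem plainStabAdd_of_localStep
    (hLS : ∀ (L : ℕ) (b₀ p₀ : ℝ), 0 < b₀ → 2 < p₀ → ∃ (k₀ M : ℕ) (γ₁ b' : ℝ), 1 ≤ k₀ ∧ 0 < γ₁ ∧ γ₁ ≤ 1 ∧ 0 < b' ∧
      ∀ η : ℝ, 0 < η → ∃ A : ℝ, ∀ (F : T3Family) (γ : ℝ), F.L = L → 0 < γ → γ ≤ γ₁ →
        ∀ q : Plaq (F.P 0) 0, ∃ (ρ t : ℕ → ℝ) (S : (K : ℕ) → Finset (Plaq (F.P (K + 1)) 0)),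
          (∀ K : ℕ, 1 / 2 ≤ t K ∧ t K ≤ 1) ∧
          (∀ k K : ℕ, k₀ ≤ k → ∑ j ∈ Finset.Ico k K, ρ j ≤ A + η * B10.pFun b₀ p₀ (Real.sqrt γ) ^ 2) ∧
          (∀ K : ℕ, k₀ ≤ K → ((S K).card : ℝ) ≤ ((F.L : ℝ) ^ (K + 1)) ^ M) ∧
          ∀ K : ℕ, k₀ ≤ K →
            (gibbsK F ℰp γ (K + 1)).real ({U | t (K + 1) * θBal F.L γ b₀ p₀ 0 ≤ GaugeGroup.dist1 (GaugeField.plaqHol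
                (Averaging.iter (fun i => BlockAveraging.blockAvg (P := F.P (K + 1)) (j := i) ℰp) (K + 1) U)
                (plaqShift (F.sitesPerDir_unit (K + 1)) q))} ∩
              {U | ∀ p ∈ S K, GaugeGroup.dist1 (GaugeField.plaqHol U p) < θBal F.L γ b' p₀ (K + 1)}) ≤
            Real.exp (ρ K) *
            (gibbsK F ℰp γ K).real {U | t K * θBal F.L γ b₀ p₀ 0 ≤ GaugeGroup.dist1 (GaugeField.plaqHol
                (Averaging.iter (fun i => BlockAveraging.blockAvg (P := F.P K) (j := i) ℰp) K U)
                (plaqShift (F.sitesPerDir_unit K) q))}) :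
    Summit.QuantumFields.YangMills.Theses.SmallFieldWidening.PlainStabAdd := by
  unfold Summit.QuantumFields.YangMills.Theses.SmallFieldWidening.PlainStabAdd
  intro L b₀ p₀ hb₀ hp₀
  obtain ⟨k₀, M, γs, b', hk₀, hγs, hγs1, hb', hstep⟩ := hLS L b₀ p₀ hb₀ hp₀
  -- the tree's volume-uniform tails: finest height (for the slack) and height `k₀` at profile `b₀/2` (for the base)
  obtain ⟨γf, C, c, N, hγf, hγf1, hc, hC, hfin⟩ := perPlaquette_boundedHeight_uniform 0 L b' p₀ hb' (by linarith)
  obtain ⟨γb, Cb, cb, Nb, hγb, hγb1, hcb, hCb, hbase⟩ :=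
    perPlaquette_boundedHeight_uniform k₀ L (b₀ / 2) p₀ (half_pos hb₀) (by linarith)
  by_cases hL : 1 < L
  swap
  · refine ⟨1, 0, 0, 1, 0, 1, 0, 1, 0, 0, le_rfl, one_pos, le_rfl, le_rfl, le_rfl, le_rfl, one_pos, one_pos, fun F γ hFL => ?_⟩
    exact absurd (hFL ▸ F.hL.2) hL
  have hp₀1 : 1 ≤ p₀ := by linarith
  set Cτ : ℝ := 2 * (C * Real.exp (c * b' ^ 2) *
      Real.exp ((((M : ℝ) + N) * Real.log L + Real.log 2) ^ 2 / (4 * (c * b' ^ 2 * Real.log L ^ 2 / 4)))) with hCτ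
  set cτ : ℝ := c * (b' / b₀) ^ 2 with hcτ
  have hcτ0 : 0 < cτ := by positivity
  have hcb4 : 0 < cb / 4 := by positivity
  set η : ℝ := min (cb / 4) cτ / 2 with hη
  have hη0 : 0 < η := by positivity
  have hηb : η < cb / 4 := by
    have := min_le_left (cb / 4) cτ
    rw [hη]; linarith
  have hητ : η < cτ := by
    have := min_le_right (cb / 4) cτ
    rw [hη]; linarith
  obtain ⟨A, hA⟩ := hstep η hη0
  refine ⟨k₀, Nb, N, min (min γf γb) γs, Cb, cb / 4, Cτ, cτ, η, A, hk₀, lt_min (lt_min hγf hγb) hγs,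
    (min_le_right _ _).trans hγs1, hCb, by positivity, hη0.le, hηb, hητ, fun F γ hFL hγ hle q => ?_⟩
  have hleF : γ ≤ γf := hle.trans ((min_le_left _ _).trans (min_le_left _ _))
  have hleB : γ ≤ γb := hle.trans ((min_le_left _ _).trans (min_le_right _ _))
  have hγ1 : γ ≤ 1 := hleF.trans hγf1
  obtain ⟨ρ, t, S, ht, hρ, hS, hst⟩ := hA F γ hFL hγ (hle.trans (min_le_right _ _)) q
  refine ⟨ρ, fun K => ((S K).card : ℝ) * (C * ((γ * ((F.L : ℝ)⁻¹) ^ (K + 1))⁻¹) ^ N *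
      Real.exp (-(c * B10.pFun b' p₀ (Real.sqrt (γ * ((F.L : ℝ)⁻¹) ^ (K + 1))) ^ 2))), t, ht, ?_, hρ,
    fun K => by positivity, fun K => ?_, fun K hK => ?_⟩
  · -- the base at run `k₀`: `t_{k₀}θ_{b₀}(0) ≥ θ_{b₀/2}(0)`, then the tree's height-`k₀` tail, volume-uniform
    haveI := isProbabilityMeasure_gibbsK F ℰp hγ.le k₀
    have hb := hbase F γ hFL hγ hleB k₀ k₀ le_rfl le_rfl (plaqShift (F.sitesPerDir_unit k₀) q)
    simp only [Nat.sub_self, pow_zero, mul_one] at hb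
    have hθ : θBal F.L γ (b₀ / 2) p₀ 0 ≤ t k₀ * θBal F.L γ b₀ p₀ 0 := by
      rw [θBal_half]
      have hθ0 : 0 ≤ θBal F.L γ b₀ p₀ 0 := by
        unfold θBal
        exact mul_nonneg (Real.sqrt_nonneg _) (B10.pFun_nonneg _ _ _ hb₀.le (Real.sqrt_pos.mpr (by simpa using hγ))
          (Real.sqrt_le_one.mpr (by simpa using hγ1)))
      nlinarith [(ht k₀).1]
    refine (measureReal_mono (fun U hU => hθ.trans hU) (measure_ne_top _ _)).trans (hb.trans (le_of_eq ?_))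
    rw [pFun_sq_rescale hb₀.ne' (b₀ / 2) p₀ (Real.sqrt γ)]
    congr 1
    congr 1
    field_simp
    ring
  · -- the slack budget, uniformly in `K`, `γ` and the volume
    rw [hFL]
    have hsum := slack_sum_le hL M N k₀ hb' hp₀1 hc hC hγ hγ1 (fun k => ((S k).card : ℝ)) (fun k hk => hFL ▸ hS k hk) K
    rw [pFun_sq_rescale hb₀.ne' b' p₀ (Real.sqrt γ)] at hsum
    have heq : -(c * ((b' / b₀) ^ 2 * B10.pFun b₀ p₀ (Real.sqrt γ) ^ 2)) = -(cτ * B10.pFun b₀ p₀ (Real.sqrt γ) ^ 2) := by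
      rw [hcτ]; ring
    rw [heq] at hsum
    exact hsum
  · -- the step: split on the local finest-small-field event, union bound on its complement
    haveI := isProbabilityMeasure_gibbsK F ℰp hγ.le (K + 1)
    have hb : ∀ p : Plaq (F.P (K + 1)) 0,
        (gibbsK F ℰp γ (K + 1)).real {U | θBal F.L γ b' p₀ (K + 1) ≤ GaugeGroup.dist1 (GaugeField.plaqHol U p)} ≤
          C * ((γ * ((F.L : ℝ)⁻¹) ^ (K + 1))⁻¹) ^ N *
            Real.exp (-(c * B10.pFun b' p₀ (Real.sqrt (γ * ((F.L : ℝ)⁻¹) ^ (K + 1))) ^ 2)) := fun p =>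
      hfin F γ hFL hγ hleF (K + 1) 0 (Nat.zero_le _) le_rfl p
    set E : Set (GaugeField (F.P (K + 1)) 0 (Matrix.specialUnitaryGroup (Fin 2) ℂ)) :=
      {U | t (K + 1) * θBal F.L γ b₀ p₀ 0 ≤ GaugeGroup.dist1 (GaugeField.plaqHol
        (Averaging.iter (fun i => BlockAveraging.blockAvg (P := F.P (K + 1)) (j := i) ℰp) (K + 1) U)
        (plaqShift (F.sitesPerDir_unit (K + 1)) q))} with hE
    set G : Set (GaugeField (F.P (K + 1)) 0 (Matrix.specialUnitaryGroup (Fin 2) ℂ)) :=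
      {U | ∀ p ∈ S K, GaugeGroup.dist1 (GaugeField.plaqHol U p) < θBal F.L γ b' p₀ (K + 1)} with hG
    have hsplit : E ⊆ (E ∩ G) ∪ ⋃ p ∈ S K,
        {U : GaugeField (F.P (K + 1)) 0 (Matrix.specialUnitaryGroup (Fin 2) ℂ) |
          θBal F.L γ b' p₀ (K + 1) ≤ GaugeGroup.dist1 (GaugeField.plaqHol U p)} := by
      intro U hU
      by_cases hGU : U ∈ G
      · exact Or.inl ⟨hU, hGU⟩
      · right
        simp only [hG, Set.mem_setOf_eq, not_forall, not_lt, exists_prop] at hGU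
        obtain ⟨p, hp, hle'⟩ := hGU
        exact Set.mem_iUnion₂.mpr ⟨p, hp, hle'⟩
    calc (gibbsK F ℰp γ (K + 1)).real E
        ≤ (gibbsK F ℰp γ (K + 1)).real ((E ∩ G) ∪ ⋃ p ∈ S K,
            {U : GaugeField (F.P (K + 1)) 0 (Matrix.specialUnitaryGroup (Fin 2) ℂ) |
              θBal F.L γ b' p₀ (K + 1) ≤ GaugeGroup.dist1 (GaugeField.plaqHol U p)}) :=
          measureReal_mono hsplit (measure_ne_top _ _)
      _ ≤ (gibbsK F ℰp γ (K + 1)).real (E ∩ G) + (gibbsK F ℰp γ (K + 1)).real (⋃ p ∈ S K,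
            {U : GaugeField (F.P (K + 1)) 0 (Matrix.specialUnitaryGroup (Fin 2) ℂ) |
              θBal F.L γ b' p₀ (K + 1) ≤ GaugeGroup.dist1 (GaugeField.plaqHol U p)}) :=
          measureReal_union_le _ _
      _ ≤ Real.exp (ρ K) * (gibbsK F ℰp γ K).real {U | t K * θBal F.L γ b₀ p₀ 0 ≤ GaugeGroup.dist1 (GaugeField.plaqHol
              (Averaging.iter (fun i => BlockAveraging.blockAvg (P := F.P K) (j := i) ℰp) K U)
              (plaqShift (F.sitesPerDir_unit K) q))} +
            ∑ p ∈ S K, (gibbsK F ℰp γ (K + 1)).real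
              {U : GaugeField (F.P (K + 1)) 0 (Matrix.specialUnitaryGroup (Fin 2) ℂ) |
                θBal F.L γ b' p₀ (K + 1) ≤ GaugeGroup.dist1 (GaugeField.plaqHol U p)} :=
          add_le_add (hst K hK) (measureReal_biUnion_finset_le _ _)
      _ ≤ Real.exp (ρ K) * (gibbsK F ℰp γ K).real {U | t K * θBal F.L γ b₀ p₀ 0 ≤ GaugeGroup.dist1 (GaugeField.plaqHol
              (Averaging.iter (fun i => BlockAveraging.blockAvg (P := F.P K) (j := i) ℰp) K U)
              (plaqShift (F.sitesPerDir_unit K) q))} +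
            ∑ _p ∈ S K, C * ((γ * ((F.L : ℝ)⁻¹) ^ (K + 1))⁻¹) ^ N *
              Real.exp (-(c * B10.pFun b' p₀ (Real.sqrt (γ * ((F.L : ℝ)⁻¹) ^ (K + 1))) ^ 2)) :=
          add_le_add le_rfl (Finset.sum_le_sum fun p _ => hb p)
      _ = _ := by rw [Finset.sum_const, nsmul_eq_mul]

end Summit.QuantumFields.YangMills.Theorems.PlainStabAddOfLocalStep

end
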